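import Literature.Geometry.Symplectic.SteinShapeInequalities
import Mathlib.Analysis.SpecialFunctions.Log.Deriv
import Mathlib.Analysis.SpecialFunctions.SmoothTransition
import HarnessLib

/-!
# The flat start of Eliashberg's handle profile: joining the tube `{|x| = σ}` smoothly

Topic `Literature/Geometry/Symplectic`; proofs file of the fact seat of
`Literature.Geometry.Symplectic.Gompf1998_thm13_twoHandles` (**E2**, `SteinTwoHandles.lean`).
Eliashberg's standard handlebody (Eliashberg 1990, Lemma 3.4.3 = Forstnerič–Kozak 2003,
Prop. 3.1, Cor. 3.2) is `K = {x + iy ∈ ℂ² : |x| ≤ h(|y|)}` for a profile `h = f⁻¹` which is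
*constant* `= σ` for small `|y|` (there `∂K` is the tube `{|x| = σ}` around the core disc) and
then increases; strong pseudoconvexity of `∂K` is the pair of inequalities
`h (h'' + h'³/u) < 1`, `h h'/u < 1` (Forstnerič–Kozak (3.1) = "(lab8)"), equivalently
`f (f'' + f'³/t) > 1`, `f f'/t > 1` for `f = h⁻¹` ((3.2), Remark 2.3 (A);
`SteinShapeInequalities.lean`).  Forstnerič–Kozak start the increasing part with
`f' = 2√σ/√(t - σ)` (Case 3 of the proof of Prop. 3.1), which makes `h` only `C¹` at the
junction `u = f(σ)` with the constant, and then smooth: *"The final solution is obtained by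
smoothing `h := f⁻¹` in a small neighborhood of any point of discontinuity of its second
derivative"*.  This file replaces that piece by an explicit `C^∞`-flat junction, so that no
smoothing is needed there: with `w = 2σL₀²`, `κ = σ e^{L₀}`,

* `startFn σ L₀ r₀ t = r₀ + w / log(κ/(t - σ))` on `t > σ`, with derivative
  `startSlope σ L₀ t = w / ((t - σ) log²(κ/(t - σ)))` (`hasDerivAt_startFn`) — so
  `f'(σ+) = +∞` as in Prop. 3.1 (iii) — and second derivative
  `-(w/((t - σ)² log²))(1 - 2/log)` (`hasDerivAt_startSlope`);
* its inverse **`startInv σ L₀ r₀ u = σ + κ · expNegInvGlue((u - r₀)/w)`** (Mathlib's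
  `expNegInvGlue x = e^{-1/x}` for `x > 0`, `0` for `x ≤ 0`): `C^∞` on `ℝ`
  (`contDiff_startInv`), `= σ` for `u ≤ r₀` (`startInv_of_le`), inverse to `startFn`
  (`startFn_startInv`, `startInv_startFn`);
* **the inequalities (3.2) on `σ < t ≤ 2σ`** for `L₀ ≥ 4`, `r₀ > σ` (`start_shape_ineq`):
  there `f' ≥ 2` and `w²/((t - σ) t log⁴) ≥ 2` (elementary: `1 + x/L₀ ≤ e^{x/4}`), whence
  `f (f'' + f'³/t) > 2 r₀/σ > 1` and `f f'/t ≥ r₀/σ > 1` — Case 3 of Forstnerič–Kozak with a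
  different profile;
* hence **(3.1) for `h = startInv` on `r₀ < u ≤ startFn(2σ)`** (`startInv_shape_ineq`, through
  `shape_inverse_iff`) and trivially on `u ≤ r₀`, where `h' = h'' = 0`
  (`startInv_shape_ineq_of_le`; at `u = r₀` by flatness, `deriv_startInv_of_le`,
  `deriv_deriv_startInv_of_le`).

Everything is **proved**; three definitions (`startFn`, `startSlope`, `startInv`), no named
fact.

## References

* F. Forstnerič, J. Kozak, *Strongly pseudoconvex handlebodies*, J. Korean Math. Soc. 40
  (2003), 727–745 (arXiv:math/0305237), Prop. 3.1 (proof, Case 3; (iii), (iv)), Cor. 3.2,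
  Remark 2.3 (A). [ForstnericKozak2003]
* Ya. Eliashberg, *Topological characterization of Stein manifolds of dimension > 2*,
  Internat. J. Math. 1 (1990), 29–46, Lemma 3.4.3. [Eliashberg1990Stein]
-/

noncomputable section

open Set Filter
open scoped Topology ContDiff

namespace Literature.Geometry.Symplectic

/-! ### §1 The start pieces -/

/-- `L(s) = L₀ + log(σ/s) = log(κ/s)`, `κ = σ e^{L₀}`: the logarithm in the start profile.
[cite: ForstnericKozak2003, Prop. 3.1] -/
def startLog (σ L₀ s : ℝ) : ℝ := L₀ + Real.log (σ / s)

/-- **The start of the profile `u = f(t)`**: `f(t) = r₀ + w / L(t - σ)`, `w = 2σL₀²`.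
[cite: ForstnericKozak2003, Prop. 3.1] -/
def startFn (σ L₀ r₀ t : ℝ) : ℝ := r₀ + 2 * σ * L₀ ^ 2 / startLog σ L₀ (t - σ)

/-- **Its slope** `f'(t) = w / ((t - σ) L(t - σ)²)`. [cite: ForstnericKozak2003, Prop. 3.1] -/
def startSlope (σ L₀ t : ℝ) : ℝ := 2 * σ * L₀ ^ 2 / ((t - σ) * startLog σ L₀ (t - σ) ^ 2)

/-- **The inverse profile** `h(u) = σ + κ · expNegInvGlue((u - r₀)/w)`: the `C^∞`-flat
junction of the tube radius `σ` (for `u ≤ r₀`) with the increasing part.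
[cite: ForstnericKozak2003, Prop. 3.1] -/
def startInv (σ L₀ r₀ u : ℝ) : ℝ :=
  σ + σ * Real.exp L₀ * expNegInvGlue ((u - r₀) / (2 * σ * L₀ ^ 2))

variable {σ L₀ r₀ : ℝ}

/-- `L(s) = L₀ + log σ - log s` for `σ, s > 0`. [folklore] -/
theorem startLog_eq (hσ : 0 < σ) {s : ℝ} (hs : 0 < s) :
    startLog σ L₀ s = L₀ + Real.log σ - Real.log s := by
  rw [startLog, Real.log_div hσ.ne' hs.ne']
  ring

/-- `L(s) ≥ L₀` for `0 < s ≤ σ`. [folklore] -/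
theorem le_startLog {s : ℝ} (hs : 0 < s) (hsσ : s ≤ σ) : L₀ ≤ startLog σ L₀ s := by
  have : 0 ≤ Real.log (σ / s) := Real.log_nonneg ((one_le_div hs).2 hsσ)
  rw [startLog]; linarith

/-- `e^{L(s) - L₀} = σ/s`. [folklore] -/
theorem exp_startLog_sub (hσ : 0 < σ) {s : ℝ} (hs : 0 < s) :
    Real.exp (startLog σ L₀ s - L₀) = σ / s := by
  rw [startLog, add_sub_cancel_left, Real.exp_log (div_pos hσ hs)]

/-- **`d/dt L(t - σ) = -1/(t - σ)`**. [folklore] -/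
theorem hasDerivAt_startLog (hσ : 0 < σ) {t : ℝ} (ht : σ < t) :
    HasDerivAt (fun t => startLog σ L₀ (t - σ)) (-(1 / (t - σ))) t := by
  have hs : 0 < t - σ := by linarith
  have h1 : HasDerivAt (fun t => Real.log (t - σ)) (1 / (t - σ)) t :=
    ((hasDerivAt_id' t).sub_const σ).log hs.ne'
  have h2 : HasDerivAt (fun t => L₀ + Real.log σ - Real.log (t - σ)) (0 - 1 / (t - σ)) t :=
    (hasDerivAt_const t (L₀ + Real.log σ)).sub h1
  have heq : (fun t => startLog σ L₀ (t - σ)) =ᶠ[𝓝 t] fun t => L₀ + Real.log σ - Real.log (t - σ) := by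
    filter_upwards [Ioi_mem_nhds ht] with t' ht'
    exact startLog_eq hσ (by simpa using ht')
  exact (h2.congr_of_eventuallyEq heq).congr_deriv (by ring)

/-- **`f' = startSlope`**: `d/dt (r₀ + w/L) = w/((t - σ)L²)` for `σ < t`, `L(t - σ) ≠ 0`.
[cite: ForstnericKozak2003, Prop. 3.1] -/
theorem hasDerivAt_startFn (hσ : 0 < σ) {t : ℝ} (ht : σ < t) (hL : startLog σ L₀ (t - σ) ≠ 0) :
    HasDerivAt (startFn σ L₀ r₀) (startSlope σ L₀ t) t := by
  have hs : 0 < t - σ := by linarith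
  have h1 := (hasDerivAt_startLog (L₀ := L₀) hσ ht).inv hL
  have h2 := (h1.const_mul (2 * σ * L₀ ^ 2)).const_add r₀
  have h3 : HasDerivAt (startFn σ L₀ r₀)
      (2 * σ * L₀ ^ 2 * (-(-(1 / (t - σ))) / startLog σ L₀ (t - σ) ^ 2)) t :=
    h2.congr_of_eventuallyEq (Eventually.of_forall fun t' => by
      simp [startFn, div_eq_mul_inv])
  refine h3.congr_deriv ?_
  rw [startSlope]
  field_simp

/-- **`f''`**: `d/dt (w/((t - σ)L²)) = -(w/((t - σ)²L²)) (1 - 2/L)` for `σ < t`, `L ≠ 0`.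
[cite: ForstnericKozak2003, Prop. 3.1] -/
theorem hasDerivAt_startSlope (hσ : 0 < σ) {t : ℝ} (ht : σ < t) (hL : startLog σ L₀ (t - σ) ≠ 0) :
    HasDerivAt (startSlope σ L₀)
      (-(2 * σ * L₀ ^ 2 / ((t - σ) ^ 2 * startLog σ L₀ (t - σ) ^ 2)) *
        (1 - 2 / startLog σ L₀ (t - σ))) t := by
  have hs : 0 < t - σ := by linarith
  -- `D(t) = (t - σ) L²`, `D' = L² - 2L`
  have hLd := hasDerivAt_startLog (L₀ := L₀) hσ ht
  have hD : HasDerivAt (fun t => (t - σ) * startLog σ L₀ (t - σ) ^ 2)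
      (1 * startLog σ L₀ (t - σ) ^ 2 +
        (t - σ) * (2 * startLog σ L₀ (t - σ) ^ 1 * -(1 / (t - σ)))) t :=
    ((hasDerivAt_id t).sub_const σ).mul (hLd.pow 2)
  have hD0 : (t - σ) * startLog σ L₀ (t - σ) ^ 2 ≠ 0 := mul_ne_zero hs.ne' (pow_ne_zero 2 hL)
  have h1 := (hD.inv hD0).const_mul (2 * σ * L₀ ^ 2)
  have h2 : HasDerivAt (startSlope σ L₀)
      (2 * σ * L₀ ^ 2 *
        (-(1 * startLog σ L₀ (t - σ) ^ 2 +
            (t - σ) * (2 * startLog σ L₀ (t - σ) ^ 1 * -(1 / (t - σ)))) /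
          ((t - σ) * startLog σ L₀ (t - σ) ^ 2) ^ 2)) t :=
    h1.congr_of_eventuallyEq (Eventually.of_forall fun t' => by
      simp [startSlope, div_eq_mul_inv])
  refine h2.congr_deriv ?_
  field_simp
  ring

/-! ### §2 Elementary bounds on `σ < t ≤ 2σ` -/

/-- `1 + x/L₀ ≤ e^{x/2}` for `x ≥ 0`, `L₀ ≥ 2`. [folklore] -/
theorem one_add_div_le_exp_half {x L₀ : ℝ} (hx : 0 ≤ x) (hL : 2 ≤ L₀) :
    1 + x / L₀ ≤ Real.exp (x / 2) := by
  have h1 : x / L₀ ≤ x / 2 := div_le_div_of_nonneg_left hx (by norm_num) hL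
  have h2 : x / 2 + 1 ≤ Real.exp (x / 2) := Real.add_one_le_exp _
  linarith

/-- `1 + x/L₀ ≤ e^{x/4}` for `x ≥ 0`, `L₀ ≥ 4`. [folklore] -/
theorem one_add_div_le_exp_quarter {x L₀ : ℝ} (hx : 0 ≤ x) (hL : 4 ≤ L₀) :
    1 + x / L₀ ≤ Real.exp (x / 4) := by
  have h1 : x / L₀ ≤ x / 4 := div_le_div_of_nonneg_left hx (by norm_num) hL
  have h2 : x / 4 + 1 ≤ Real.exp (x / 4) := Real.add_one_le_exp _
  linarith

/-- **`s L(s)² ≤ σ L₀²` for `0 < s ≤ σ`** (`L₀ ≥ 2`): with `x = log(σ/s) ≥ 0`,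
`(1 + x/L₀)² ≤ e^{x} = σ/s`. [folklore] -/
theorem mul_startLog_sq_le (hσ : 0 < σ) (hL : 2 ≤ L₀) {s : ℝ} (hs : 0 < s) (hsσ : s ≤ σ) :
    s * startLog σ L₀ s ^ 2 ≤ σ * L₀ ^ 2 := by
  set x := Real.log (σ / s) with hx
  have hx0 : 0 ≤ x := Real.log_nonneg ((one_le_div hs).2 hsσ)
  have hL0 : 0 < L₀ := by linarith
  have hexp : Real.exp x = σ / s := Real.exp_log (div_pos hσ hs)
  have h1 : (1 + x / L₀) ^ 2 ≤ Real.exp x := by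
    have h2 := one_add_div_le_exp_half hx0 hL
    have h3 : 0 ≤ 1 + x / L₀ := by positivity
    calc (1 + x / L₀) ^ 2 ≤ Real.exp (x / 2) ^ 2 := pow_le_pow_left₀ h3 h2 2
      _ = Real.exp x := by rw [← Real.exp_nat_mul]; ring_nf
  have hL' : startLog σ L₀ s = L₀ * (1 + x / L₀) := by
    rw [startLog, ← hx]; field_simp
  rw [hL', mul_pow, hexp] at *
  have h4 : s * (L₀ ^ 2 * (1 + x / L₀) ^ 2) ≤ s * (L₀ ^ 2 * (σ / s)) := by
    rw [hexp] at h1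
    exact mul_le_mul_of_nonneg_left (mul_le_mul_of_nonneg_left h1 (by positivity)) hs.le
  calc s * (L₀ ^ 2 * (1 + x / L₀) ^ 2) ≤ s * (L₀ ^ 2 * (σ / s)) := h4
    _ = σ * L₀ ^ 2 := by field_simp

/-- **`s L(s)⁴ ≤ σ L₀⁴` for `0 < s ≤ σ`** (`L₀ ≥ 4`). [folklore] -/
theorem mul_startLog_pow_four_le (hσ : 0 < σ) (hL : 4 ≤ L₀) {s : ℝ} (hs : 0 < s) (hsσ : s ≤ σ) :
    s * startLog σ L₀ s ^ 4 ≤ σ * L₀ ^ 4 := by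
  set x := Real.log (σ / s) with hx
  have hx0 : 0 ≤ x := Real.log_nonneg ((one_le_div hs).2 hsσ)
  have hL0 : 0 < L₀ := by linarith
  have hexp : Real.exp x = σ / s := Real.exp_log (div_pos hσ hs)
  have h1 : (1 + x / L₀) ^ 4 ≤ Real.exp x := by
    have h2 := one_add_div_le_exp_quarter hx0 hL
    have h3 : 0 ≤ 1 + x / L₀ := by positivity
    calc (1 + x / L₀) ^ 4 ≤ Real.exp (x / 4) ^ 4 := pow_le_pow_left₀ h3 h2 4
      _ = Real.exp x := by rw [← Real.exp_nat_mul]; ring_nf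
  have hL' : startLog σ L₀ s = L₀ * (1 + x / L₀) := by
    rw [startLog, ← hx]; field_simp
  rw [hL', mul_pow]
  rw [hexp] at h1
  calc s * (L₀ ^ 4 * (1 + x / L₀) ^ 4) ≤ s * (L₀ ^ 4 * (σ / s)) :=
        mul_le_mul_of_nonneg_left (mul_le_mul_of_nonneg_left h1 (by positivity)) hs.le
    _ = σ * L₀ ^ 4 := by field_simp

/-- **`f' ≥ 2` on `σ < t ≤ 2σ`** (`L₀ ≥ 2`). [cite: ForstnericKozak2003, Prop. 3.1] -/
theorem two_le_startSlope (hσ : 0 < σ) (hL : 2 ≤ L₀) {t : ℝ} (ht : σ < t) (ht2 : t ≤ 2 * σ) :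
    2 ≤ startSlope σ L₀ t := by
  have hs : 0 < t - σ := by linarith
  have hsσ : t - σ ≤ σ := by linarith
  have hLt : L₀ ≤ startLog σ L₀ (t - σ) := le_startLog hs hsσ
  have hL0 : 0 < startLog σ L₀ (t - σ) := by linarith
  have hD : 0 < (t - σ) * startLog σ L₀ (t - σ) ^ 2 := by positivity
  rw [startSlope, le_div_iff₀ hD]
  have := mul_startLog_sq_le (L₀ := L₀) hσ hL hs hsσ
  linarith

/-! ### §3 The inequalities (3.2) of Forstnerič–Kozak on the start piece -/

/-- **The start piece satisfies `f (f'' + f'³/t) > 1` and `f f'/t > 1` on `σ < t ≤ 2σ`**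
(`L₀ ≥ 4`, `r₀ > σ`): Case 3 of the proof of Forstnerič–Kozak's Prop. 3.1 for the
logarithmically flat profile.  Indeed `f ≥ r₀`, `f' ≥ 2`, and
`f'' + f'³/t = (w/((t-σ)²L²)) (w²/((t-σ) t L⁴) - 1 + 2/L)` with `w²/((t-σ) t L⁴) ≥ 2`.
[cite: ForstnericKozak2003, Prop. 3.1] -/
theorem start_shape_ineq (hσ : 0 < σ) (hL : 4 ≤ L₀) (hr : σ < r₀) {t : ℝ} (ht : σ < t)
    (ht2 : t ≤ 2 * σ) :
    1 < startFn σ L₀ r₀ t *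
        (-(2 * σ * L₀ ^ 2 / ((t - σ) ^ 2 * startLog σ L₀ (t - σ) ^ 2)) *
            (1 - 2 / startLog σ L₀ (t - σ)) + startSlope σ L₀ t ^ 3 / t) ∧
      1 < startFn σ L₀ r₀ t * startSlope σ L₀ t / t := by
  have hs : 0 < t - σ := by linarith
  have hsσ : t - σ ≤ σ := by linarith
  have ht0 : 0 < t := by linarith
  set L := startLog σ L₀ (t - σ) with hLdef
  have hLt : L₀ ≤ L := le_startLog hs hsσ
  have hL4 : 4 ≤ L := le_trans hL hLt
  have hL0 : 0 < L := by linarith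
  set w := 2 * σ * L₀ ^ 2 with hw
  have hw0 : 0 < w := by positivity
  -- `f ≥ r₀`
  have hf : r₀ < startFn σ L₀ r₀ t := by
    have : 0 < w / L := div_pos hw0 hL0
    rw [startFn]; linarith
  have hfpos : 0 < startFn σ L₀ r₀ t := by linarith
  -- `f' ≥ 2`
  have hfp : 2 ≤ startSlope σ L₀ t := two_le_startSlope hσ (by linarith) ht ht2
  have hslope : startSlope σ L₀ t = w / ((t - σ) * L ^ 2) := rfl
  refine ⟨?_, ?_⟩
  · -- the first inequality
    have h4 := mul_startLog_pow_four_le (L₀ := L₀) hσ hL hs hsσ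
    -- `w² ≥ 2 (t - σ) t L⁴`
    have hkey : 2 * ((t - σ) * t * L ^ 4) ≤ w ^ 2 := by
      have h5 : (t - σ) * t * L ^ 4 ≤ 2 * σ * (σ * L₀ ^ 4) := by
        calc (t - σ) * t * L ^ 4 = t * ((t - σ) * L ^ 4) := by ring
          _ ≤ (2 * σ) * (σ * L₀ ^ 4) :=
            mul_le_mul ht2 h4 (by positivity) (by positivity)
          _ = 2 * σ * (σ * L₀ ^ 4) := by ring
      rw [hw]; nlinarith
    -- rewrite the bracket
    have hexpr : -(w / ((t - σ) ^ 2 * L ^ 2)) * (1 - 2 / L) + startSlope σ L₀ t ^ 3 / t =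
        (w / ((t - σ) ^ 2 * L ^ 2)) * (w ^ 2 / ((t - σ) * t * L ^ 4) - 1 + 2 / L) := by
      rw [hslope]
      field_simp
      ring
    rw [hexpr]
    have hb : 1 < w ^ 2 / ((t - σ) * t * L ^ 4) - 1 + 2 / L := by
      have h6 : 2 ≤ w ^ 2 / ((t - σ) * t * L ^ 4) := by
        rw [le_div_iff₀ (by positivity)]; linarith
      have h7 : 0 < 2 / L := by positivity
      linarith
    have hA : 0 < w / ((t - σ) ^ 2 * L ^ 2) := by positivity
    -- `f (A b) > r₀ A ≥ r₀ f'/(t-σ) ≥ 2 r₀/σ > 1`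
    have hA' : w / ((t - σ) ^ 2 * L ^ 2) = startSlope σ L₀ t / (t - σ) := by
      rw [hslope]; field_simp
    have h8 : 2 / σ ≤ w / ((t - σ) ^ 2 * L ^ 2) := by
      rw [hA']
      calc 2 / σ ≤ 2 / (t - σ) := div_le_div_of_nonneg_left (by norm_num) hs hsσ
        _ ≤ startSlope σ L₀ t / (t - σ) := div_le_div_of_nonneg_right hfp hs.le
    have h9 : 1 < r₀ * (2 / σ) := by
      rw [mul_div_assoc', lt_div_iff₀ hσ]; linarith
    calc (1 : ℝ) < r₀ * (2 / σ) := h9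
      _ ≤ startFn σ L₀ r₀ t * (w / ((t - σ) ^ 2 * L ^ 2)) :=
          mul_le_mul hf.le h8 (by positivity) hfpos.le
      _ = startFn σ L₀ r₀ t * (w / ((t - σ) ^ 2 * L ^ 2)) * 1 := (mul_one _).symm
      _ < startFn σ L₀ r₀ t * (w / ((t - σ) ^ 2 * L ^ 2)) *
            (w ^ 2 / ((t - σ) * t * L ^ 4) - 1 + 2 / L) :=
          mul_lt_mul_of_pos_left hb (mul_pos hfpos hA)
      _ = startFn σ L₀ r₀ t * ((w / ((t - σ) ^ 2 * L ^ 2)) *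
            (w ^ 2 / ((t - σ) * t * L ^ 4) - 1 + 2 / L)) := by ring
  · -- the second inequality: `f f'/t ≥ r₀ 2/(2σ) = r₀/σ > 1`
    have h1 : 1 < r₀ * 2 / (2 * σ) := by
      rw [lt_div_iff₀ (by positivity)]; linarith
    calc (1 : ℝ) < r₀ * 2 / (2 * σ) := h1
      _ ≤ startFn σ L₀ r₀ t * startSlope σ L₀ t / (2 * σ) :=
          div_le_div_of_nonneg_right (mul_le_mul hf.le hfp (by norm_num) hfpos.le) (by positivity)
      _ ≤ startFn σ L₀ r₀ t * startSlope σ L₀ t / t :=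
          div_le_div_of_nonneg_left (by positivity) ht0 ht2

/-! ### §4 The inverse profile -/

/-- `startInv` is `C^∞`. [folklore] -/
theorem contDiff_startInv {n : ℕ∞} : ContDiff ℝ n (startInv σ L₀ r₀) := by
  have h1 : ContDiff ℝ n fun u : ℝ => (u - r₀) / (2 * σ * L₀ ^ 2) :=
    (contDiff_id.sub contDiff_const).div_const _
  exact contDiff_const.add (contDiff_const.mul (expNegInvGlue.contDiff.comp h1))

/-- `startInv u = σ` for `u ≤ r₀` (`σ, L₀ > 0`). [cite: ForstnericKozak2003, Prop. 3.1] -/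
theorem startInv_of_le (hσ : 0 < σ) (hL : 0 < L₀) {u : ℝ} (hu : u ≤ r₀) : startInv σ L₀ r₀ u = σ := by
  have h : (u - r₀) / (2 * σ * L₀ ^ 2) ≤ 0 :=
    div_nonpos_of_nonpos_of_nonneg (by linarith) (by positivity)
  rw [startInv, expNegInvGlue.zero_of_nonpos h, mul_zero, add_zero]

/-- For `u > r₀`: `startInv u = σ + κ e^{-w/(u - r₀)}`. [folklore] -/
theorem startInv_of_lt (hσ : 0 < σ) (hL : 0 < L₀) {u : ℝ} (hu : r₀ < u) :
    startInv σ L₀ r₀ u = σ + σ * Real.exp L₀ * Real.exp (-(2 * σ * L₀ ^ 2 / (u - r₀))) := by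
  have hpos : 0 < (u - r₀) / (2 * σ * L₀ ^ 2) := div_pos (by linarith) (by positivity)
  rw [startInv, expNegInvGlue, if_neg (not_le.2 hpos)]
  congr 2
  rw [inv_div]

/-- `startInv u > σ` for `u > r₀`. [folklore] -/
theorem lt_startInv (hσ : 0 < σ) (hL : 0 < L₀) {u : ℝ} (hu : r₀ < u) : σ < startInv σ L₀ r₀ u := by
  rw [startInv_of_lt hσ hL hu]
  have : 0 < σ * Real.exp L₀ * Real.exp (-(2 * σ * L₀ ^ 2 / (u - r₀))) := by positivity
  linarith

/-- **`f (h u) = u` for `u > r₀`.** [cite: ForstnericKozak2003, Prop. 3.1] -/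
theorem startFn_startInv (hσ : 0 < σ) (hL : 0 < L₀) {u : ℝ} (hu : r₀ < u) :
    startFn σ L₀ r₀ (startInv σ L₀ r₀ u) = u := by
  have hur : 0 < u - r₀ := by linarith
  rw [startInv_of_lt hσ hL hu, startFn]
  have hs : startLog σ L₀ (σ + σ * Real.exp L₀ * Real.exp (-(2 * σ * L₀ ^ 2 / (u - r₀))) - σ) =
      2 * σ * L₀ ^ 2 / (u - r₀) := by
    rw [add_sub_cancel_left, startLog]
    have h1 : σ / (σ * Real.exp L₀ * Real.exp (-(2 * σ * L₀ ^ 2 / (u - r₀)))) =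
        Real.exp (-L₀ + 2 * σ * L₀ ^ 2 / (u - r₀)) := by
      rw [Real.exp_add, Real.exp_neg, Real.exp_neg]
      field_simp
    rw [h1, Real.log_exp]
    ring
  rw [hs]
  field_simp
  ring

/-- **`h (f t) = t` for `t > σ` with `L(t - σ) > 0`** (e.g. `t ≤ 2σ`).
[cite: ForstnericKozak2003, Prop. 3.1] -/
theorem startInv_startFn (hσ : 0 < σ) (hL : 0 < L₀) {t : ℝ} (ht : σ < t)
    (hLt : 0 < startLog σ L₀ (t - σ)) : startInv σ L₀ r₀ (startFn σ L₀ r₀ t) = t := by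
  have hs : 0 < t - σ := by linarith
  have hw : 0 < 2 * σ * L₀ ^ 2 := by positivity
  have hu : r₀ < startFn σ L₀ r₀ t := by
    have : 0 < 2 * σ * L₀ ^ 2 / startLog σ L₀ (t - σ) := div_pos hw hLt
    rw [startFn]; linarith
  rw [startInv_of_lt hσ hL hu]
  have h1 : startFn σ L₀ r₀ t - r₀ = 2 * σ * L₀ ^ 2 / startLog σ L₀ (t - σ) := by
    rw [startFn]; ring
  have h5 : 2 * σ * L₀ ^ 2 / (2 * σ * L₀ ^ 2 / startLog σ L₀ (t - σ)) = startLog σ L₀ (t - σ) := by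
    field_simp
  rw [h1, h5]
  -- `σ e^{L₀} e^{-L} = t - σ`
  have h2 : Real.exp (-startLog σ L₀ (t - σ)) = (t - σ) / σ * Real.exp (-L₀) := by
    have h3 := exp_startLog_sub (L₀ := L₀) hσ hs
    have h4 : Real.exp (-startLog σ L₀ (t - σ)) = (Real.exp (startLog σ L₀ (t - σ) - L₀))⁻¹ * Real.exp (-L₀) := by
      rw [← Real.exp_neg, ← Real.exp_add]; ring_nf
    rw [h4, h3, inv_div]
  rw [h2, Real.exp_neg]
  field_simp
  ring

/-- `startFn t > r₀` when `L(t - σ) > 0` (`σ, L₀ > 0`). [folklore] -/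
theorem lt_startFn (hσ : 0 < σ) (hL : 0 < L₀) {t : ℝ} (hLt : 0 < startLog σ L₀ (t - σ)) :
    r₀ < startFn σ L₀ r₀ t := by
  have : 0 < 2 * σ * L₀ ^ 2 / startLog σ L₀ (t - σ) := div_pos (by positivity) hLt
  rw [startFn]; linarith

/-! ### §5 Derivatives of the inverse profile and the inequalities (3.1) -/

/-- **`h' (u)` for `u > r₀`**: `d/du (σ + κ e^{-w/(u-r₀)}) = κ e^{-w/(u-r₀)} w/(u-r₀)²`.
[folklore] -/
theorem hasDerivAt_startInv_of_lt (hσ : 0 < σ) (hL : 0 < L₀) {u : ℝ} (hu : r₀ < u) :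
    HasDerivAt (startInv σ L₀ r₀)
      (σ * Real.exp L₀ * (Real.exp (-(2 * σ * L₀ ^ 2 / (u - r₀))) *
        (2 * σ * L₀ ^ 2 / (u - r₀) ^ 2))) u := by
  have hur : 0 < u - r₀ := by linarith
  -- the exponent `E(u) = -(w/(u - r₀))` and its derivative
  have hE : HasDerivAt (fun u => -(2 * σ * L₀ ^ 2 / (u - r₀))) (2 * σ * L₀ ^ 2 / (u - r₀) ^ 2) u := by
    have h1 : HasDerivAt (fun u => u - r₀) 1 u := (hasDerivAt_id' u).sub_const r₀
    have h2 := (h1.inv hur.ne').const_mul (2 * σ * L₀ ^ 2)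
    have h3 := h2.neg
    refine (h3.congr_of_eventuallyEq (Eventually.of_forall fun u' => ?_)).congr_deriv ?_
    · simp [div_eq_mul_inv]
    · field_simp
  have hexp := hE.exp
  have h4 := (hexp.const_mul (σ * Real.exp L₀)).const_add σ
  refine h4.congr_of_eventuallyEq ?_
  filter_upwards [Ioi_mem_nhds hu] with u' hu'
  rw [startInv_of_lt hσ hL (by simpa using hu')]

/-- `h' (u) > 0` for `u > r₀`. [folklore] -/
theorem deriv_startInv_pos (hσ : 0 < σ) (hL : 0 < L₀) {u : ℝ} (hu : r₀ < u) :
    0 < deriv (startInv σ L₀ r₀) u := by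
  have hur : 0 < u - r₀ := by linarith
  rw [(hasDerivAt_startInv_of_lt hσ hL hu).deriv]
  positivity

/-- **`h' (u) = 0` for `u ≤ r₀`**: on `u < r₀` the profile is locally constant, and `r₀` is a
minimum point of `h ≥ σ` (Fermat). [folklore] -/
theorem deriv_startInv_of_le (hσ : 0 < σ) (hL : 0 < L₀) {u : ℝ} (hu : u ≤ r₀) :
    deriv (startInv σ L₀ r₀) u = 0 := by
  rcases hu.lt_or_eq with hu' | hu'
  · have h : (startInv σ L₀ r₀) =ᶠ[𝓝 u] fun _ => σ := by
      filter_upwards [Iio_mem_nhds hu'] with u'' hu''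
      exact startInv_of_le hσ hL (le_of_lt hu'')
    rw [h.deriv_eq]; simp
  · subst hu'
    apply IsLocalMin.deriv_eq_zero
    refine Eventually.of_forall fun u' => ?_
    rw [startInv_of_le hσ hL le_rfl]
    rcases le_or_gt u' u with h | h
    · rw [startInv_of_le hσ hL h]
    · exact (lt_startInv hσ hL h).le

/-- **`h'' (u) = 0` for `u ≤ r₀`**: `h'` vanishes on `u ≤ r₀` and is positive on `u > r₀`, so
`r₀` is a minimum point of `h'` (Fermat again; `h'` is differentiable as `h` is `C^∞`).
[folklore] -/
theorem deriv_deriv_startInv_of_le (hσ : 0 < σ) (hL : 0 < L₀) {u : ℝ} (hu : u ≤ r₀) :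
    deriv (deriv (startInv σ L₀ r₀)) u = 0 := by
  rcases hu.lt_or_eq with hu' | hu'
  · have h : deriv (startInv σ L₀ r₀) =ᶠ[𝓝 u] fun _ => 0 := by
      filter_upwards [Iio_mem_nhds hu'] with u'' hu''
      exact deriv_startInv_of_le hσ hL hu''.le
    rw [h.deriv_eq]; simp
  · subst hu'
    apply IsLocalMin.deriv_eq_zero
    refine Eventually.of_forall fun u' => ?_
    rw [deriv_startInv_of_le hσ hL le_rfl]
    rcases le_or_gt u' u with h | h
    · rw [deriv_startInv_of_le hσ hL h]
    · exact (deriv_startInv_pos hσ hL h).le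

/-- **(3.1) on the tube part `0 < u ≤ r₀`**: `h = σ`, `h' = h'' = 0`, so
`h (h'' + h'³/u) = 0 < 1` and `h h'/u = 0 < 1`. [cite: ForstnericKozak2003, Prop. 3.1] -/
theorem startInv_shape_ineq_of_le (hσ : 0 < σ) (hL : 0 < L₀) {u : ℝ} (hu : u ≤ r₀) :
    startInv σ L₀ r₀ u * (deriv (deriv (startInv σ L₀ r₀)) u + deriv (startInv σ L₀ r₀) u ^ 3 / u) < 1 ∧
      startInv σ L₀ r₀ u * deriv (startInv σ L₀ r₀) u / u < 1 := by
  rw [deriv_startInv_of_le hσ hL hu, deriv_deriv_startInv_of_le hσ hL hu]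
  norm_num

/-- **(3.1) of Forstnerič–Kozak for the inverse profile on `r₀ < u`, `h(u) ≤ 2σ`** (`L₀ ≥ 4`,
`r₀ > σ`): `h (h'' + h'³/u) < 1` and `h h'/u < 1`, by Remark 2.3 (A) (`shape_inverse_iff`)
from the inequalities (3.2) for `f` on `σ < t ≤ 2σ` (`start_shape_ineq`).
[cite: ForstnericKozak2003, Prop. 3.1] -/
theorem startInv_shape_ineq (hσ : 0 < σ) (hL : 4 ≤ L₀) (hr : σ < r₀) {u : ℝ} (hu : r₀ < u)
    (hu2 : startInv σ L₀ r₀ u ≤ 2 * σ) :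
    startInv σ L₀ r₀ u * (deriv (deriv (startInv σ L₀ r₀)) u + deriv (startInv σ L₀ r₀) u ^ 3 / u) < 1 ∧
      startInv σ L₀ r₀ u * deriv (startInv σ L₀ r₀) u / u < 1 := by
  have hL0 : 0 < L₀ := by linarith
  set t := startInv σ L₀ r₀ u with htdef
  have ht : σ < t := lt_startInv hσ hL0 hu
  have hs : 0 < t - σ := by linarith
  have hu0 : 0 < u := by linarith
  have ht0 : 0 < t := by linarith
  -- `L > 0` at `t` and nearby
  have hLt : L₀ ≤ startLog σ L₀ (t - σ) := le_startLog hs (by linarith)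
  have hLpos : 0 < startLog σ L₀ (t - σ) := by linarith
  have hLc : ContinuousAt (fun x => startLog σ L₀ (x - σ)) t := (hasDerivAt_startLog hσ ht).continuousAt
  have hLev : ∀ᶠ x in 𝓝 t, σ < x ∧ 0 < startLog σ L₀ (x - σ) := by
    filter_upwards [Ioi_mem_nhds ht, hLc.eventually (Ioi_mem_nhds hLpos)] with x h1 h2
    exact ⟨h1, h2⟩
  -- the hypotheses of `shape_inverse_iff`
  have hh : ∀ᶠ y in 𝓝 u, ContinuousAt (startInv σ L₀ r₀) y :=
    Eventually.of_forall fun y => (contDiff_startInv (n := ⊤)).continuous.continuousAt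
  have hf : ∀ᶠ x in 𝓝 t, HasDerivAt (startFn σ L₀ r₀) (startSlope σ L₀ x) x := by
    filter_upwards [hLev] with x hx
    exact hasDerivAt_startFn hσ hx.1 hx.2.ne'
  have hp0 : 0 < startSlope σ L₀ t := lt_of_lt_of_le (by norm_num) (two_le_startSlope hσ (by linarith) ht hu2)
  have hf'd := hasDerivAt_startSlope (L₀ := L₀) hσ ht hLpos.ne'
  have hfh : ∀ᶠ y in 𝓝 u, startFn σ L₀ r₀ (startInv σ L₀ r₀ y) = y := by
    filter_upwards [Ioi_mem_nhds hu] with y hy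
    exact startFn_startInv hσ hL0 hy
  have key := (shape_inverse_iff (f := startFn σ L₀ r₀) (f' := startSlope σ L₀) (h := startInv σ L₀ r₀)
    hu0 ht0 hh hf rfl hp0 hf'd.continuousAt hf'd hfh).1
  apply key
  have h9 := start_shape_ineq (L₀ := L₀) hσ hL hr ht hu2
  rw [startFn_startInv hσ hL0 hu] at h9
  exact h9

end Literature.Geometry.Symplectic

end
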